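import Summits.BirchSwinnertonDyer.Rank1Residual.X11b.RegMultCertificateJoin
import Literature.Barriers.BirchSwinnertonDyer.PAdicHeightNondegeneracyProofs
import Literature.NumberTheory.EllipticCurves.MordellWeilTheoremProofs
import Summits.BirchSwinnertonDyer.BirchSwinnertonDyer.Theses.ClassRecordThree
import HarnessLib

/-!
# Route `ClassRecordThree`, crux `SchneiderAtThree` (item 19106): the registered skeleton is TIGHT —
# the deciding stub `stub_heightAnisotropicNonsplitAtThree` is EQUIVALENT to the crux modulo the other stub
# `stub_rankOneOfClassX11bAtThree` (= GZK on the class), by tree theorems only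
# (cell `bsd-stepL`, seat `bsd-stepL-reg3-eng` g7; `--supports stmt-BirchSwinnertonDyer-19106 --as helper`)

HONEST FRAMING: nothing here proves the crux, a stub, or BSD; 0 definitions, 0 named facts, 0 sorry. The crux
`SchneiderAtThree` (Schneider non-degeneracy of THE canonical non-split-multiplicative `3`-adic height on the whole
class X11b@3 ∧ (ram) ∧ ¬split(3)) is an OPEN PROBLEM class-wide (barrier
`Literature.Barriers.BirchSwinnertonDyer.PAdicHeightNondegeneracy`); its registered BC3 skeleton
(`Cruxes/SchneiderAtThree`, planner g24, sha f6e21e29…) composes it from two stubs,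

* `stub_rankOneOfClassX11bAtThree : ∀ W, ClassX11b W 3 → rank_ℤ E(ℚ) = 1` (Gross–Zagier–Kolyvagin on the
  class; the route's PUB item 19921 `RankEqAnalyticRankLeOne` by name — `rankOne_of_GZK` below), and
* `stub_heightAnisotropicNonsplitAtThree` (ANISOTROPY: for THE canonical datum `IsMultCanonical Dh q` every
  rational point of infinite order has `⟨P,P⟩ ≠ 0`).

This file records the CONVERSE of the skeleton's composition: GIVEN the rank-one stub, the crux IMPLIES the
anisotropy stub (`anisotropy_of_schneiderAtThree`: in rank one an isotropic non-torsion point makes the `1 × 1`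
regulator vanish, `PAdicHeightData.not_schneiderConjecture_of_rank_one`), hence
`schneiderAtThree_iff_anisotropy` — the deciding stub is NOT a strengthening of the crux: a disproof of the stub
is a disproof of the crux (mod GZK), and conversely every per-pair certificate of the crux's matrix (REG3CERT,
`Reg3Cert.rung_of_mem_reg3certModels`, 723 ∕ 723 TRUE-OPEN classes below `5·10⁵`) is a per-pair instance of
the stub. With GZK supplied by name: `schneiderAtThree_iff_anisotropy_of_GZK`.

References: [SteinWuthrich2013] §4.2 and Conj. 4.1; [Schneider1982PadicHeightI] §1; tree files
`Literature/Barriers/BirchSwinnertonDyer/PAdicHeightNondegeneracyProofs.lean` (rank-one algebra),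
`X11b/RegMultCertificateJoin.lean` (`mordellWeilRank_eq_one_of_analyticRank`).
-/

open scoped Classical

open WeierstrassCurve Literature.NumberTheory.EllipticCurves
  Literature.NumberTheory.EllipticCurves.Rank1Residual
  Literature.NumberTheory.EllipticCurves.SteinWuthrich2013
  Summit.BirchSwinnertonDyer.Rank1Residual
  Summit.BirchSwinnertonDyer.Rank1Residual.X11b

namespace Summit.BirchSwinnertonDyer.Rank1Residual.X11b.RegMult.SchneiderAtThreeStub

/-- **Crux ⟹ deciding stub, given rank one.** If every `W` of class X11b at `3` has Mordell–Weil rank one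
(the skeleton's first stub, verbatim as a hypothesis) and `SchneiderAtThree` holds, then THE canonical non-split
`3`-adic height is anisotropic on points of infinite order (the skeleton's deciding stub, verbatim as the
conclusion): an isotropic non-torsion `P` would give `Reg₃(E, Dh) = det(⟨P₁,P₁⟩) = 0`
(`PAdicHeightData.not_schneiderConjecture_of_rank_one`), contradicting the non-split half of
`ClassClosure.RegulatorNonvanishingAt W 3`. [folklore] -/
theorem anisotropy_of_schneiderAtThree
    (hr : ∀ (W : WeierstrassCurve ℚ) [W.IsElliptic] [W.IsGloballyMinimal],
      Summit.BirchSwinnertonDyer.Rank1Residual.ClassX11b W 3 → W.mordellWeilRank = 1)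
    (h : Summit.BirchSwinnertonDyer.BirchSwinnertonDyer.Theses.ClassRecordThree.SchneiderAtThree) :
    ∀ (W : WeierstrassCurve ℚ) [W.IsElliptic] [W.IsGloballyMinimal],
      Summit.BirchSwinnertonDyer.Rank1Residual.ClassX11b W 3 →
      Literature.NumberTheory.EllipticCurves.Rank1Residual.Ram W 3 →
      ¬ W.HasSplitMultiplicativeReductionAtPrime 3 →
      ∀ (q : ℚ_[3]) (Dh : WeierstrassCurve.PAdicHeightData W 3), q ≠ 0 → ‖q‖ < 1 →
        Literature.NumberTheory.EllipticCurves.tateJ q = (W.j : ℚ_[3]) →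
        Literature.NumberTheory.EllipticCurves.SteinWuthrich2013.IsMultCanonical Dh q →
        ∀ (P : W.toAffine.Point), ¬ IsOfFinAddOrder P → Dh.pairing P P ≠ 0 := by
  intro W _ _ hX hram hns q Dh hq0 hq1 hj hcan P hP hPP
  exact Dh.not_schneiderConjecture_of_rank_one (hr W hX) hP hPP ((h W hX hram hns).1 q Dh hq0 hq1 hj hcan)

/-- **Deciding stub ⟹ crux, given rank one** (the skeleton's composition `SchneiderAtThree_of`, restated with
both stubs as hypotheses so that the equivalence below is one theorem): rank one + anisotropy ⟹ `Reg₃ ≠ 0` for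
the canonical non-split datum (`PAdicHeightData.not_schneiderConjecture_iff_of_rank_one` with the Mordell–Weil
THEOREM `exists_isMordellWeilBasis_holds`); the split clause of `RegulatorNonvanishingAt` is vacuous at a
non-split prime (`TateParameterData.split`). [folklore] -/
theorem schneiderAtThree_of_anisotropy
    (hr : ∀ (W : WeierstrassCurve ℚ) [W.IsElliptic] [W.IsGloballyMinimal],
      Summit.BirchSwinnertonDyer.Rank1Residual.ClassX11b W 3 → W.mordellWeilRank = 1)
    (ha : ∀ (W : WeierstrassCurve ℚ) [W.IsElliptic] [W.IsGloballyMinimal],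
      Summit.BirchSwinnertonDyer.Rank1Residual.ClassX11b W 3 →
      Literature.NumberTheory.EllipticCurves.Rank1Residual.Ram W 3 →
      ¬ W.HasSplitMultiplicativeReductionAtPrime 3 →
      ∀ (q : ℚ_[3]) (Dh : WeierstrassCurve.PAdicHeightData W 3), q ≠ 0 → ‖q‖ < 1 →
        Literature.NumberTheory.EllipticCurves.tateJ q = (W.j : ℚ_[3]) →
        Literature.NumberTheory.EllipticCurves.SteinWuthrich2013.IsMultCanonical Dh q →
        ∀ (P : W.toAffine.Point), ¬ IsOfFinAddOrder P → Dh.pairing P P ≠ 0) :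
    Summit.BirchSwinnertonDyer.BirchSwinnertonDyer.Theses.ClassRecordThree.SchneiderAtThree := by
  intro W _ _ hX hram hns
  refine ⟨fun q Dh hq0 hq1 hj hcan ↦ ?_, fun Dq Dh _ ↦ absurd Dq.split hns⟩
  by_contra hS
  obtain ⟨P, hP, hPP⟩ :=
    (Dh.not_schneiderConjecture_iff_of_rank_one (hr W hX) W.exists_isMordellWeilBasis_holds).mp hS
  exact ha W hX hram hns q Dh hq0 hq1 hj hcan P hP hPP

/-- **TIGHTNESS of the registered skeleton of crux 19106**: modulo its first stub (rank one on class X11b@3),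
the crux `SchneiderAtThree` is EQUIVALENT to its deciding stub `stub_heightAnisotropicNonsplitAtThree`
(both texts verbatim). [folklore] -/
theorem schneiderAtThree_iff_anisotropy
    (hr : ∀ (W : WeierstrassCurve ℚ) [W.IsElliptic] [W.IsGloballyMinimal],
      Summit.BirchSwinnertonDyer.Rank1Residual.ClassX11b W 3 → W.mordellWeilRank = 1) :
    Summit.BirchSwinnertonDyer.BirchSwinnertonDyer.Theses.ClassRecordThree.SchneiderAtThree ↔
    ∀ (W : WeierstrassCurve ℚ) [W.IsElliptic] [W.IsGloballyMinimal],
      Summit.BirchSwinnertonDyer.Rank1Residual.ClassX11b W 3 →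
      Literature.NumberTheory.EllipticCurves.Rank1Residual.Ram W 3 →
      ¬ W.HasSplitMultiplicativeReductionAtPrime 3 →
      ∀ (q : ℚ_[3]) (Dh : WeierstrassCurve.PAdicHeightData W 3), q ≠ 0 → ‖q‖ < 1 →
        Literature.NumberTheory.EllipticCurves.tateJ q = (W.j : ℚ_[3]) →
        Literature.NumberTheory.EllipticCurves.SteinWuthrich2013.IsMultCanonical Dh q →
        ∀ (P : W.toAffine.Point), ¬ IsOfFinAddOrder P → Dh.pairing P P ≠ 0 :=
  ⟨fun h W _ _ ↦ anisotropy_of_schneiderAtThree hr h W,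
    fun ha ↦ schneiderAtThree_of_anisotropy hr (fun W _ _ ↦ ha W)⟩

/-- **The first stub from GZK by name**: `stub_rankOneOfClassX11bAtThree` (text verbatim) from the named fact
`rank_eq_analyticRank_of_analyticRank_le_one` (the route's PUB item 19921 `RankEqAnalyticRankLeOne`), since
`analyticRank = 1` is the first conjunct of `ClassX11b` (`mordellWeilRank_eq_one_of_analyticRank`).
[cite: KolyvaginEulerSystems1990, Thm. A] -/
theorem rankOne_of_GZK (hGZK : rank_eq_analyticRank_of_analyticRank_le_one) :
    ∀ (W : WeierstrassCurve ℚ) [W.IsElliptic] [W.IsGloballyMinimal],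
      Summit.BirchSwinnertonDyer.Rank1Residual.ClassX11b W 3 → W.mordellWeilRank = 1 :=
  fun _ _ _ hX ↦ mordellWeilRank_eq_one_of_analyticRank hGZK hX.1

/-- **TIGHTNESS modulo GZK**: `SchneiderAtThree ↔ stub_heightAnisotropicNonsplitAtThree` given the named fact
`rank_eq_analyticRank_of_analyticRank_le_one`. [cite: KolyvaginEulerSystems1990, Thm. A]
[cite: SteinWuthrich2013, §4.2 and Conj. 4.1] -/
theorem schneiderAtThree_iff_anisotropy_of_GZK (hGZK : rank_eq_analyticRank_of_analyticRank_le_one) :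
    Summit.BirchSwinnertonDyer.BirchSwinnertonDyer.Theses.ClassRecordThree.SchneiderAtThree ↔
    ∀ (W : WeierstrassCurve ℚ) [W.IsElliptic] [W.IsGloballyMinimal],
      Summit.BirchSwinnertonDyer.Rank1Residual.ClassX11b W 3 →
      Literature.NumberTheory.EllipticCurves.Rank1Residual.Ram W 3 →
      ¬ W.HasSplitMultiplicativeReductionAtPrime 3 →
      ∀ (q : ℚ_[3]) (Dh : WeierstrassCurve.PAdicHeightData W 3), q ≠ 0 → ‖q‖ < 1 →
        Literature.NumberTheory.EllipticCurves.tateJ q = (W.j : ℚ_[3]) →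
        Literature.NumberTheory.EllipticCurves.SteinWuthrich2013.IsMultCanonical Dh q →
        ∀ (P : W.toAffine.Point), ¬ IsOfFinAddOrder P → Dh.pairing P P ≠ 0 :=
  schneiderAtThree_iff_anisotropy (rankOne_of_GZK hGZK)

end Summit.BirchSwinnertonDyer.Rank1Residual.X11b.RegMult.SchneiderAtThreeStub
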